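import Mathlib
import HarnessLib
import Summits.NavierStokesRegularity.NavierStokesRegularity.Theorems.TypeILiouvilleShorelinePlanarWall
import Summits.NavierStokesRegularity.NavierStokesRegularity.Theorems.TypeILiouvilleStrainLedgerStarved
import Literature.Analysis.PDE.HeatLiouville
import Literature.Analysis.FluidPDE.EssCurry
import Literature.Analysis.FluidPDE.ClassicalSolutionGalilean
import Literature.Analysis.FluidPDE.ConstantinDirectionDissipationCalculus

/-!
# TypeILiouvilleShorelinePlanarWallVertical — crux (L) stmt-NavierStokesRegularity-10661 `TypeIliouvilleL`:
# THE 2½-D WALL IS CLOSED ON PRINT'S CLASS — line-invariant bounded ancient mild flows are constant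

Helper for stmt-NavierStokesRegularity-10661 (`--supports`); theorems only, no definitions, no named-fact hypotheses;
closes no item; Navier–Stokes regularity is NOT proved here (leafhand seat of the EulerZoomLiouville route; completes
`TypeILiouvilleShorelinePlanarWall`).  Class P = print's class of bounded ancient mild solutions.

* `classP_const_of_lineInvariant` — **A NEW PROVED SECTOR OF (L): a class-P flow invariant under all translations along
  `e₁ = EuclideanSpace.single 1 1` is ONE CONSTANT VECTOR.**  Horizontal part: `TypeILiouvilleShorelinePlanarWall`
  (KNSS Thm 5.1).  Vertical part (this file): with `(v₀, v₂) ≡ (b₀, b₂)` the vorticity is `ω = (−∂₂v₁, 0, ∂₀v₁)`, the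
  stretching `Dv[ω]` VANISHES identically and the transport is `Dω[b]`, `b = b₀e₀ + b₂e₂`; so by the class-P vorticity
  equation (`TypeILiouvilleStrainLedger.classP_vorticity_eq`) `∂ₜω + Dω[b] = Δω`, and in the Galilean frame
  `θ(t,y) = ω(t, y + t b)` the bounded smooth field `θ` solves the heat equation on `(−∞,0) × ℝ³`; the tree's classical
  heat Liouville theorem (`Literature.Analysis.PDE.heat_liouville`) makes `ω` one constant vector `c`; `c₁ = 0`, and
  `c₀ = −∂₂v₁`, `c₂ = ∂₀v₁` vanish because `v₁` is bounded along lines; finally `curl v ≡ 0` forces a constant flow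
  (`TypeILiouvilleStrainLedger.const_of_curl_eq_zero`).
* `classP_const_of_locallyLineInvariant` — the same from invariance under SMALL translations along `e₁` on ONE nonempty
  open set of ONE slice (`classP_translationInvariant_of_locally`): **locally 2½-dimensional anywhere ⟹ trivial.**
[cite: KochNadirashviliSereginSverak2009, Thm. 5.1 (arXiv p. 9), Remark 6.1, proof of Thm. 6.2 (p. 13); LemarieRieusset2016, Thm. 9.12]
-/

noncomputable section
open MeasureTheory Filter Set Function Metric
open scoped Topology ENNReal RealInnerProductSpace Laplacian ContDiff
open Literature.Analysis Literature.Analysis.FluidPDE Literature.Analysis.UnboundedOperators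
set_option linter.dupNamespace false
namespace Summit.NavierStokesRegularity.NavierStokesRegularity.Theorems.TypeILiouvilleShoreline

/-- The directional derivative along an invariance direction vanishes. [folklore] -/
theorem fderiv_apply_eq_zero_of_translationInvariant {F' : Type*} [NormedAddCommGroup F'] [NormedSpace ℝ F']
    {f : EuclideanSpace ℝ (Fin 3) → F'} {e : EuclideanSpace ℝ (Fin 3)}
    (h : ∀ (y : EuclideanSpace ℝ (Fin 3)) (s : ℝ), f (y + s • e) = f y) (x : EuclideanSpace ℝ (Fin 3)) :
    fderiv ℝ f x e = 0 := by
  by_cases hf : DifferentiableAt ℝ f x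
  · have hγ : HasDerivAt (fun s : ℝ => x + s • e) e 0 := by
      have h1 := ((hasDerivAt_id (0 : ℝ)).smul_const e).const_add x
      simpa using h1
    have h1 : HasDerivAt (fun s : ℝ => f (x + s • e)) (fderiv ℝ f x e) 0 := by
      have hfx : HasFDerivAt f (fderiv ℝ f x) (x + (0 : ℝ) • e) := by simpa using hf.hasFDerivAt
      exact hfx.comp_hasDerivAt (0 : ℝ) hγ
    have h2 : HasDerivAt (fun s : ℝ => f (x + s • e)) 0 0 := by
      have : (fun s : ℝ => f (x + s • e)) = fun _ => f x := funext fun s => h x s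
      rw [this]; exact hasDerivAt_const 0 (f x)
    exact h1.unique h2
  · rw [fderiv_zero_of_not_differentiableAt hf]; rfl

/-- A coordinate of the derivative vanishes when that coordinate of the map is constant. [folklore] -/
theorem fderiv_apply_coord_eq_zero_of_const
    {f : EuclideanSpace ℝ (Fin 3) → EuclideanSpace ℝ (Fin 3)} {i : Fin 3} {c : ℝ} (h : ∀ y, f y i = c)
    {x : EuclideanSpace ℝ (Fin 3)} (hf : DifferentiableAt ℝ f x) (w : EuclideanSpace ℝ (Fin 3)) :
    fderiv ℝ f x w i = 0 := by
  have h1 : HasFDerivAt (⇑(EuclideanSpace.proj i : EuclideanSpace ℝ (Fin 3) →L[ℝ] ℝ) ∘ f)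
      ((EuclideanSpace.proj i).comp (fderiv ℝ f x)) x :=
    (EuclideanSpace.proj i).hasFDerivAt.comp x hf.hasFDerivAt
  have h2 : HasFDerivAt (⇑(EuclideanSpace.proj i : EuclideanSpace ℝ (Fin 3) →L[ℝ] ℝ) ∘ f)
      (0 : EuclideanSpace ℝ (Fin 3) →L[ℝ] ℝ) x := by
    have : (⇑(EuclideanSpace.proj i : EuclideanSpace ℝ (Fin 3) →L[ℝ] ℝ) ∘ f) = fun _ => c := by
      funext y; simp [h y]
    rw [this]; exact hasFDerivAt_const c x
  have h3 := congrArg (fun L : EuclideanSpace ℝ (Fin 3) →L[ℝ] ℝ => L w) (h1.unique h2)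
  simpa using h3

/-- **THE 2½-D WALL IS CLOSED ON PRINT'S CLASS: a class-P flow invariant under all translations along `e₁` is one
constant vector.**  See the module docstring for the mechanism (KNSS Thm 5.1 for the horizontal part; zero stretching +
Galilean frame + classical heat Liouville for the vorticity; bounded `v₁` along lines; curl-free Liouville).
[cite: KochNadirashviliSereginSverak2009, Thm. 5.1, Remark 6.1, proof of Thm. 6.2 (arXiv:0709.3599)] -/
theorem classP_const_of_lineInvariant
    {v : ℝ → EuclideanSpace ℝ (Fin 3) → EuclideanSpace ℝ (Fin 3)}
    (hc : ContinuousOn (uncurry v) (Iio 0 ×ˢ univ))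
    (hK : ∃ K : ℝ, ∀ t < 0, ∀ x, ‖v t x‖ ≤ K)
    (hd : ∀ t < 0, IsWeaklyDivFree (v t))
    (hm : ∀ s t : ℝ, s < t → t < 0 → ∀ x,
      v t x = heatExtension (v s) (t - s) x - oseenDuhamel 1 s v v t x)
    (hinv : ∀ t < 0, ∀ (x : EuclideanSpace ℝ (Fin 3)) (δ : ℝ), v t (x + EuclideanSpace.single 1 δ) = v t x) :
    ∃ b : EuclideanSpace ℝ (Fin 3), ∀ t < 0, ∀ x, v t x = b := by
  obtain ⟨b₀, b₂, hb⟩ := classP_horizontal_const_of_lineInvariant hc hK hd hm hinv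
  obtain ⟨K, hKb⟩ := hK
  -- notation for the coordinate vectors
  set e₀ : EuclideanSpace ℝ (Fin 3) := EuclideanSpace.single 0 (1 : ℝ) with he₀
  set e₁ : EuclideanSpace ℝ (Fin 3) := EuclideanSpace.single 1 (1 : ℝ) with he₁
  set e₂ : EuclideanSpace ℝ (Fin 3) := EuclideanSpace.single 2 (1 : ℝ) with he₂
  set bvec : EuclideanSpace ℝ (Fin 3) := b₀ • e₀ + b₂ • e₂ with hbvec
  have hsingle : ∀ s : ℝ, EuclideanSpace.single (1 : Fin 3) s = s • e₁ := fun s => by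
    ext i
    by_cases hi : i = 1
    · subst hi; simp [he₁]
    · simp [he₁, hi]
  have hinv' : ∀ t < 0, ∀ (y : EuclideanSpace ℝ (Fin 3)) (s : ℝ), v t (y + s • e₁) = v t y := fun t ht y s => by
    rw [← hsingle]; exact hinv t ht y s
  -- smoothness and bounds of class P
  obtain ⟨hsm', hbounds⟩ := smooth_and_bounds_of_bounded_ancient_oseenMild hc hd hm hKb
  have hsm : IsSmoothSpaceTimeOn (Iio 0) v := hsm'
  have hvort : IsSmoothSpaceTimeOn (Iio 0) (vorticity v) := isSmoothSpaceTimeOn_vorticity_Iio hsm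
  have hslice : ∀ t < 0, ContDiff ℝ 2 (v t) := fun t ht => (hsm.contDiff_slice (mem_Iio.2 ht)).of_le (by norm_cast)
  have hdiff : ∀ t < 0, ∀ x, DifferentiableAt ℝ (v t) x := fun t ht x => ((hslice t ht).differentiable two_ne_zero) x
  obtain ⟨C₁, hC₁⟩ := hbounds 1
  have hωbd : ∀ τ < 0, ∀ y, ‖curl (v τ) y‖ ≤ ‖curlCLM‖ * C₁ := by
    intro τ hτ y
    have h1 : ‖fderiv ℝ (v τ) y‖ ≤ C₁ := by
      have := hC₁ τ hτ y; rwa [norm_iteratedFDeriv_one] at this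
    calc ‖curl (v τ) y‖ = ‖curlCLM (fderiv ℝ (v τ) y)‖ := rfl
      _ ≤ ‖curlCLM‖ * ‖fderiv ℝ (v τ) y‖ := ContinuousLinearMap.le_opNorm _ _
      _ ≤ ‖curlCLM‖ * C₁ := mul_le_mul_of_nonneg_left h1 (norm_nonneg curlCLM)
  -- (i)–(iii): structure of the gradient and of the curl at every point
  have hLe₁ : ∀ t < 0, ∀ x, fderiv ℝ (v t) x e₁ = 0 := fun t ht x =>
    fderiv_apply_eq_zero_of_translationInvariant (fun y s => hinv' t ht y s) x
  have hL0 : ∀ t < 0, ∀ x w, fderiv ℝ (v t) x w 0 = 0 := fun t ht x w =>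
    fderiv_apply_coord_eq_zero_of_const (fun y => (hb t ht y).1) (hdiff t ht x) w
  have hL2 : ∀ t < 0, ∀ x w, fderiv ℝ (v t) x w 2 = 0 := fun t ht x w =>
    fderiv_apply_coord_eq_zero_of_const (fun y => (hb t ht y).2) (hdiff t ht x) w
  have hcurl0 : ∀ t < 0, ∀ x, curl (v t) x 0 = -(fderiv ℝ (v t) x e₂ 1) := by
    intro t ht x
    have h := (curlCLM_apply_coord (fderiv ℝ (v t) x)).1
    rw [EuclideanSpace.basisFun_apply, EuclideanSpace.basisFun_apply] at h
    change curl (v t) x 0 = _ at h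
    rw [h, ← he₁, ← he₂, hLe₁ t ht x]
    simp
  have hcurl1 : ∀ t < 0, ∀ x, curl (v t) x 1 = 0 := by
    intro t ht x
    have h := (curlCLM_apply_coord (fderiv ℝ (v t) x)).2.1
    rw [EuclideanSpace.basisFun_apply, EuclideanSpace.basisFun_apply] at h
    change curl (v t) x 1 = _ at h
    rw [h, ← he₂, ← he₀, hL0 t ht x, hL2 t ht x, sub_zero]
  have hcurl2 : ∀ t < 0, ∀ x, curl (v t) x 2 = fderiv ℝ (v t) x e₀ 1 := by
    intro t ht x
    have h := (curlCLM_apply_coord (fderiv ℝ (v t) x)).2.2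
    rw [EuclideanSpace.basisFun_apply, EuclideanSpace.basisFun_apply] at h
    change curl (v t) x 2 = _ at h
    rw [h, ← he₀, ← he₁, hLe₁ t ht x]
    simp
  -- decomposition of a vector in the coordinate basis
  have hdecomp : ∀ w : EuclideanSpace ℝ (Fin 3), w = w 0 • e₀ + w 1 • e₁ + w 2 • e₂ := by
    intro w
    have h := (EuclideanSpace.basisFun (Fin 3) ℝ).sum_repr w
    simp only [EuclideanSpace.basisFun_repr, EuclideanSpace.basisFun_apply, Fin.sum_univ_three] at h
    rw [he₀, he₁, he₂]
    exact h.symm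
  -- (iv) the stretching vanishes
  have hstretch : ∀ t < 0, ∀ x, fderiv ℝ (v t) x (curl (v t) x) = 0 := by
    intro t ht x
    set L := fderiv ℝ (v t) x with hL
    set om := curl (v t) x with hom
    rw [hdecomp om, map_add, map_add, map_smul, map_smul, map_smul, hLe₁ t ht x, smul_zero, add_zero]
    have hA : L e₀ = (L e₀ 1) • e₁ := by
      conv_lhs => rw [hdecomp (L e₀)]
      rw [hL0 t ht x, hL2 t ht x, zero_smul, zero_smul, zero_add, add_zero]
    have hB : L e₂ = (L e₂ 1) • e₁ := by
      conv_lhs => rw [hdecomp (L e₂)]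
      rw [hL0 t ht x, hL2 t ht x, zero_smul, zero_smul, zero_add, add_zero]
    rw [hA, hB, smul_smul, smul_smul, ← add_smul, hom, hcurl0 t ht x, hcurl2 t ht x]
    have : -(L e₂ 1) * (L e₀ 1) + (L e₀ 1) * (L e₂ 1) = 0 := by ring
    rw [this, zero_smul]
  -- the curl is invariant along `e₁`, hence its derivative along `e₁` vanishes
  have hcurl_inv : ∀ t < 0, ∀ (y : EuclideanSpace ℝ (Fin 3)) (s : ℝ), curl (v t) (y + s • e₁) = curl (v t) y := by
    intro t ht y s
    have hfun : (fun z => v t (z + s • e₁)) = v t := funext fun z => hinv' t ht z s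
    show curlCLM (fderiv ℝ (v t) (y + s • e₁)) = curlCLM (fderiv ℝ (v t) y)
    rw [← fderiv_comp_add_right, hfun]
  have hL'e₁ : ∀ t < 0, ∀ x, fderiv ℝ (curl (v t)) x e₁ = 0 := fun t ht x =>
    fderiv_apply_eq_zero_of_translationInvariant (fun y s => hcurl_inv t ht y s) x
  -- (v) the transport term is a constant drift
  have hdrift : ∀ t < 0, ∀ x, fderiv ℝ (curl (v t)) x (v t x) = fderiv ℝ (curl (v t)) x bvec := by
    intro t ht x
    have hvx : v t x = bvec + (v t x 1) • e₁ := by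
      conv_lhs => rw [hdecomp (v t x)]
      rw [(hb t ht x).1, (hb t ht x).2, hbvec]
      abel
    rw [hvx, map_add, map_smul, hL'e₁ t ht x, smul_zero, add_zero]
  -- (vi) the vorticity equation: `∂ₜω = Δω − Dω[b]`
  have hlaw : ∀ t < 0, ∀ x, deriv (fun s => curl (v s) x) t = (Δ (curl (v t))) x - fderiv ℝ (curl (v t)) x bvec := by
    intro t ht x
    have h := TypeILiouvilleStrainLedger.classP_vorticity_eq hc ⟨K, hKb⟩ hd hm ht x
    rw [hstretch t ht x, zero_add, hdrift t ht x] at h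
    rw [← h]; abel
  -- (vii) the Galilean frame `θ(t,y) = ω(t, y + t b)` solves the heat equation
  have hO : IsOpen (Iio (0 : ℝ) ×ˢ (univ : Set (EuclideanSpace ℝ (Fin 3)))) := isOpen_Iio.prod isOpen_univ
  have hωinf : ContDiffOn ℝ ∞ (uncurry (vorticity v)) (Iio (0 : ℝ) ×ˢ univ) := hvort
  set Φ : ℝ × EuclideanSpace ℝ (Fin 3) → ℝ × EuclideanSpace ℝ (Fin 3) := fun p => (p.1, p.2 + p.1 • bvec) with hΦ
  have hΦs : ContDiff ℝ ∞ Φ := by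
    refine contDiff_fst.prodMk (contDiff_snd.add (contDiff_fst.smul contDiff_const))
  have hΦmaps : MapsTo Φ (Iio (0 : ℝ) ×ˢ univ) (Iio (0 : ℝ) ×ˢ univ) := fun p hp => ⟨hp.1, mem_univ _⟩
  set θ : ℝ → EuclideanSpace ℝ (Fin 3) → EuclideanSpace ℝ (Fin 3) := fun t y => curl (v t) (y + t • bvec) with hθ
  have hθeq : uncurry θ = uncurry (vorticity v) ∘ Φ := by
    funext p
    obtain ⟨t, y⟩ := p
    simp [hθ, hΦ, vorticity_apply]
  have hθinf : ContDiffOn ℝ ∞ (uncurry θ) (Iio (0 : ℝ) ×ˢ univ) := by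
    rw [hθeq]
    exact hωinf.comp hΦs.contDiffOn hΦmaps
  have hθ2 : ContDiffOn ℝ 2 (uncurry θ) (Iio (0 : ℝ) ×ˢ univ) := hθinf.of_le (by norm_cast)
  have hω2 : ContDiffOn ℝ 2 (uncurry (vorticity v)) (Iio (0 : ℝ) ×ˢ univ) := hωinf.of_le (by norm_cast)
  have hheatθ : ∀ z ∈ Iio (0 : ℝ) ×ˢ (univ : Set (EuclideanSpace ℝ (Fin 3))),
      Carleman.dt (uncurry θ) z = Carleman.lap (uncurry θ) z := by
    rintro ⟨t, y⟩ hz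
    have ht : t < 0 := (mem_prod.1 hz).1
    set p : EuclideanSpace ℝ (Fin 3) := y + t • bvec with hp
    have hzp : (t, p) ∈ Iio (0 : ℝ) ×ˢ (univ : Set (EuclideanSpace ℝ (Fin 3))) := ⟨ht, mem_univ _⟩
    have hdθ : DifferentiableAt ℝ (uncurry θ) (t, y) :=
      (hθ2.differentiableOn (by norm_num)).differentiableAt (hO.mem_nhds hz)
    have hdω : DifferentiableAt ℝ (uncurry (vorticity v)) (t, p) :=
      (hω2.differentiableOn (by norm_num)).differentiableAt (hO.mem_nhds hzp)
    have hγ : HasDerivAt (fun s : ℝ => (s, y + s • bvec)) ((1 : ℝ), bvec) t := by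
      have h1 : HasDerivAt (fun s : ℝ => y + s • bvec) bvec t := by
        have := ((hasDerivAt_id t).smul_const bvec).const_add y
        simpa using this
      exact (hasDerivAt_id t).prodMk h1
    have hcomp : HasDerivAt (uncurry (vorticity v) ∘ fun s : ℝ => (s, y + s • bvec))
        (fderiv ℝ (uncurry (vorticity v)) (t, p) ((1 : ℝ), bvec)) t := by
      have hdω' : HasFDerivAt (uncurry (vorticity v)) (fderiv ℝ (uncurry (vorticity v)) (t, p))
          ((fun s : ℝ => (s, y + s • bvec)) t) := by
        simpa only [hp] using hdω.hasFDerivAt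
      exact hdω'.comp_hasDerivAt t hγ
    have hsplit : fderiv ℝ (uncurry (vorticity v)) (t, p) ((1 : ℝ), bvec) =
        timeDeriv (vorticity v) t p + fderiv ℝ (vorticity v t) p bvec := by
      have e : ((1 : ℝ), bvec) = ((1 : ℝ), (0 : EuclideanSpace ℝ (Fin 3))) + ((0 : ℝ), bvec) := by simp
      rw [e, map_add, ← Carleman.dt_apply, ← Carleman.dx_apply, Carleman.dt_uncurry hdω, Carleman.dx_uncurry hdω]
    have hdt : Carleman.dt (uncurry θ) (t, y) = timeDeriv (vorticity v) t p + fderiv ℝ (vorticity v t) p bvec := by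
      rw [Carleman.dt_uncurry hdθ, Literature.Analysis.FluidPDE.timeDeriv_apply]
      have hfun : (fun s => θ s y) = uncurry (vorticity v) ∘ fun s : ℝ => (s, y + s • bvec) := by
        funext s; simp [hθ, vorticity_apply]
      rw [hfun, hcomp.deriv, hsplit]
    have hlaw' : timeDeriv (vorticity v) t p = (Δ (vorticity v t)) p - fderiv ℝ (vorticity v t) p bvec := by
      rw [Literature.Analysis.FluidPDE.timeDeriv_apply]
      have hfun : (fun s => vorticity v s p) = fun s => curl (v s) p := by
        funext s; simp [vorticity_apply]
      rw [hfun, hlaw t ht p]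
      simp [vorticity_apply]
    have hlap : Carleman.lap (uncurry θ) (t, y) = (Δ (vorticity v t)) p := by
      rw [Carleman.lap_uncurry hO hz hθ2]
      have hfun : θ t = fun z => vorticity v t (z + t • bvec) := by
        funext z; simp [hθ, vorticity_apply]
      rw [hfun, laplacian_comp_add_right]
    rw [hdt, hlaw', hlap]
    abel
  -- (viii) heat Liouville: `θ` is one constant vector
  have key : ∀ t t' : ℝ, t < 0 → t' < 0 → ∀ y y' : EuclideanSpace ℝ (Fin 3), θ t y = θ t' y' := by
    intro t t' ht ht' y y'
    have h := Literature.Analysis.PDE.heat_liouville (u := uncurry θ) (T := 0) (A := ‖curlCLM‖ * C₁) (γ := 0) le_rfl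
      zero_lt_one hθ2 hheatθ ?_ (z := (t, y)) (w := (t', y')) (mem_prod.2 ⟨ht, mem_univ _⟩)
      (mem_prod.2 ⟨ht', mem_univ _⟩)
    · simpa using h
    · rintro ⟨τ, z⟩ hz
      have hτ : τ < 0 := (mem_prod.1 hz).1
      rw [Real.rpow_zero, mul_one]
      exact hωbd τ hτ (z + τ • bvec)
  have hconst : ∀ t < 0, ∀ x, curl (v t) x = curl (v (-1)) 0 := by
    intro t ht x
    have h := key t (-1) ht (by norm_num) (x - t • bvec) (0 - (-1 : ℝ) • bvec)
    simpa [hθ] using h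
  -- (x) the constant vorticity vanishes: `v₁` is bounded along the `e₀`- and `e₂`-lines
  set c₀ := curl (v (-1)) 0 with hc₀
  have h1 : (-1 : ℝ) < 0 := by norm_num
  -- a real function with constant derivative and bounded values has zero derivative
  have hbdd_deriv : ∀ {g : ℝ → ℝ} {m : ℝ}, (∀ s, HasDerivAt g m s) → (∀ s, |g s| ≤ K) → m = 0 := by
    intro g m hg hgK
    by_contra hm0
    have hds : ∀ s, HasDerivAt (fun y => g y - m * y) (m - m * 1) s := fun s =>
      (hg s).sub ((hasDerivAt_id' s).const_mul m)
    have hdg : Differentiable ℝ (fun y => g y - m * y) := fun s => (hds s).differentiableAt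
    have hconst := is_const_of_deriv_eq_zero hdg (fun s => by rw [(hds s).deriv]; ring)
    set s : ℝ := (2 * K + 1) / m with hs
    have h1 := hconst s 0
    simp only [mul_zero, sub_zero] at h1
    have hms : m * s = 2 * K + 1 := by rw [hs]; field_simp
    have h2 : |m * s| ≤ 2 * K := by
      have e : m * s = g s - g 0 := by linarith
      rw [e]
      calc |g s - g 0| ≤ |g s| + |g 0| := abs_sub _ _
        _ ≤ K + K := add_le_add (hgK s) (hgK 0)
        _ = 2 * K := by ring
    rw [hms] at h2
    have hK0 : 0 ≤ K := (abs_nonneg _).trans (hgK 0)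
    rw [abs_of_nonneg (by linarith)] at h2
    linarith
  have hline : ∀ (e : EuclideanSpace ℝ (Fin 3)) (m : ℝ),
      (∀ x, fderiv ℝ (v (-1)) x e 1 = m) → m = 0 := by
    intro e m hm'
    refine hbdd_deriv (g := fun s => v (-1) (s • e) 1) (fun s => ?_) fun s => ?_
    · have hγ : HasDerivAt (fun s : ℝ => s • e) e s := by
        simpa using (hasDerivAt_id s).smul_const e
      have hv : HasFDerivAt (v (-1)) (fderiv ℝ (v (-1)) (s • e)) (s • e) := (hdiff (-1) h1 _).hasFDerivAt
      have hπ := (EuclideanSpace.proj (1 : Fin 3) : EuclideanSpace ℝ (Fin 3) →L[ℝ] ℝ).hasFDerivAt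
        (x := v (-1) (s • e))
      have h := (hπ.comp _ hv).comp_hasDerivAt s hγ
      have hfun : (fun s : ℝ => v (-1) (s • e) 1) =
          (⇑(EuclideanSpace.proj (1 : Fin 3) : EuclideanSpace ℝ (Fin 3) →L[ℝ] ℝ) ∘ v (-1)) ∘ fun s : ℝ => s • e := by
        funext s; simp
      have hval : ((EuclideanSpace.proj (1 : Fin 3) : EuclideanSpace ℝ (Fin 3) →L[ℝ] ℝ).comp
          (fderiv ℝ (v (-1)) (s • e))) e = m := by
        simpa using hm' (s • e)
      rw [hfun, ← hval]
      exact h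
    · calc |v (-1) (s • e) 1| = ‖v (-1) (s • e) 1‖ := (Real.norm_eq_abs _).symm
        _ ≤ ‖v (-1) (s • e)‖ := PiLp.norm_apply_le _ _
        _ ≤ K := hKb (-1) h1 _
  have hc₀0 : c₀ 0 = 0 := by
    have hm' : ∀ x, fderiv ℝ (v (-1)) x e₂ 1 = -(c₀ 0) := fun x => by
      have := hcurl0 (-1) h1 x
      rw [hconst (-1) h1 x] at this
      linarith
    have := hline e₂ (-(c₀ 0)) hm'
    linarith
  have hc₀2 : c₀ 2 = 0 := by
    have hm' : ∀ x, fderiv ℝ (v (-1)) x e₀ 1 = c₀ 2 := fun x => by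
      have := hcurl2 (-1) h1 x
      rw [hconst (-1) h1 x] at this
      exact this.symm
    exact hline e₀ (c₀ 2) hm'
  have hc₀1 : c₀ 1 = 0 := by rw [hc₀]; exact hcurl1 (-1) h1 0
  have hc₀z : c₀ = 0 := by
    rw [hdecomp c₀, hc₀0, hc₀1, hc₀2]; simp
  -- (xi) curl-free ⟹ constant
  exact TypeILiouvilleStrainLedger.const_of_curl_eq_zero hc ⟨K, hKb⟩ hd hm fun t ht x => by
    rw [hconst t ht x, hc₀z]

/-- **LOCALLY 2½-DIMENSIONAL ANYWHERE ⟹ TRIVIAL.**  A class-P flow with `v t₀ (x + s•e₁) = v t₀ x` for `x` in ONE nonempty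
open set and all `|s| < δ` (`t₀ < 0`) is one constant vector (`classP_translationInvariant_of_locally` +
`classP_const_of_lineInvariant`). [cite: KochNadirashviliSereginSverak2009, Thm. 5.1 (arXiv p. 9); LemarieRieusset2016, Thm. 9.12] -/
theorem classP_const_of_locallyLineInvariant
    {v : ℝ → EuclideanSpace ℝ (Fin 3) → EuclideanSpace ℝ (Fin 3)}
    (hc : ContinuousOn (uncurry v) (Iio 0 ×ˢ univ))
    (hK : ∃ K : ℝ, ∀ t < 0, ∀ x, ‖v t x‖ ≤ K)
    (hd : ∀ t < 0, IsWeaklyDivFree (v t))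
    (hm : ∀ s t : ℝ, s < t → t < 0 → ∀ x,
      v t x = heatExtension (v s) (t - s) x - oseenDuhamel 1 s v v t x)
    {t₀ δ : ℝ} (ht₀ : t₀ < 0) (hδ : 0 < δ)
    {U : Set (EuclideanSpace ℝ (Fin 3))} (hUo : IsOpen U) (hUne : U.Nonempty)
    (h : ∀ s ∈ Ioo (-δ) δ, ∀ x ∈ U, v t₀ (x + s • EuclideanSpace.single 1 (1 : ℝ)) = v t₀ x) :
    ∃ b : EuclideanSpace ℝ (Fin 3), ∀ t < 0, ∀ x, v t x = b := by
  have hglob := classP_translationInvariant_of_locally hc hK hm (EuclideanSpace.single 1 (1 : ℝ)) ht₀ hδ hUo hUne h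
  refine classP_const_of_lineInvariant hc hK hd hm fun t ht x s => ?_
  have hsingle : EuclideanSpace.single (1 : Fin 3) s = s • EuclideanSpace.single (1 : Fin 3) (1 : ℝ) := by
    ext i
    by_cases hi : i = 1
    · subst hi; simp
    · simp [hi]
  rw [hsingle]
  exact hglob t ht s x

end Summit.NavierStokesRegularity.NavierStokesRegularity.Theorems.TypeILiouvilleShoreline

end
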